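import Literature.AlgebraicGeometry.Motives.RestrictScalarsBetti
import HarnessLib

/-!
# Naturality of `Hⁱ(Z|_k(ℂ); ℚ) ≅ ∏_σ Hⁱ(Z_σ(ℂ); ℚ)` in the `K`-scheme `Z`

Layer `Literature/AlgebraicGeometry/Motives`, complement to `RestrictScalarsBetti`
(`bettiCohomologyRestrictScalarsEquiv Z i : Hⁱ(Z|_k(ℂ); ℚ) ≃ₗ[ℚ] ∏_{σ : K →ₐ[k] ℂ} Hⁱ(Z_σ(ℂ); ℚ)`
for a `K`-scheme `Z` regarded over a subfield `k ⊆ K`, `[K : k] < ∞`). A `K`-morphism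
`φ : Z ⟶ Z'` induces the `k`-morphism `φ|_k : Z|_k ⟶ Z'|_k` (`Over.map`) and, for every
`k`-embedding `σ : K → ℂ`, the `ℂ`-morphism `φ_σ : Z_σ ⟶ Z'_σ` (`baseChangeHom σ`); this file
proves that the decomposition is natural:

* `pieceIncl_comp_mapContinuous_baseChangeHom` — on complex points, the inclusion of the piece
  `Z_σ(ℂ) ≃ₜ {P | σ_P = σ} ⊆ Z|_k(ℂ)` intertwines `φ_σ(ℂ)` and `φ|_k(ℂ)` (all three are
  post-composition of morphisms `Spec ℂ ⟶ ·`, and `π_{Z'} ∘ φ_σ = φ ∘ π_Z` for the projections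
  `π : Z_σ ⟶ Z`, `Motives.baseChangeHom_map_left_comp_fst`);
* `bettiCohomologyRestrictScalarsEquiv_map` — **naturality**: the `σ`-component of
  `(φ|_k)* z'` is `(φ_σ)*` of the `σ`-component of `z'`; bundled as an identity of linear maps in
  `bettiCohomologyRestrictScalarsEquiv_comp_map`;
* `bettiCohomologyRestrictScalarsEquiv_map_mapAut` — in particular the decomposition is
  equivariant for the automorphism group `Aut Z` of the `K`-scheme (acting on `Z|_k` and on each
  `Z_σ` through the functors `Over.map`, `baseChangeHom σ`; Mathlib `Functor.mapAut`).

This is the form in which a group of `K`-automorphisms of a variety over a number field `K` (e.g.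
Scholl's group `Γ` on a Kuga–Sato variety over `ℚ(ζ_n)`, Deninger–Scholl 1991, §4.1, 5.3 (i)) acts
compatibly on the Betti cohomology of the `ℚ`-scheme `Z|_ℚ` and on that of its geometric components
`Z_σ`. Everything is proved; no named facts (D-0014).

## References

* C. Deninger, A. J. Scholl, *The Beilinson conjectures*, LMS LNS 153 (1991), §4.1, 5.1.
  [DeningerScholl1991]
* A. Hatcher, *Algebraic Topology*, CUP 2002, §3.1 (functoriality of singular cohomology).
  [HatcherAT2002]
-/

noncomputable section

open CategoryTheory Topology AlgebraicGeometry

namespace Literature.AlgebraicGeometry.Motives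

open Literature.AlgebraicTopology.SingularHomology

variable {k : Type} [Field k] [Algebra k ℂ] {K : Type} [Field K] [Algebra k K] {Z Z' : SchemeOver K}

/-- The underlying morphism of the inclusion of the `σ`-piece applied to `Q ∈ Z_σ(ℂ)` is
`Q ≫ π_Z` (restatement of `pieceHomeomorphBaseChange_apply_coe_left` for the bundled inclusion).
[folklore] -/
theorem pieceIncl_apply_left (σ : K →ₐ[k] ℂ) (Q : ComplexPoints ((baseChangeHom σ.toRingHom).obj Z)) :
    (((subsetIncl {P : ComplexPoints (Z.restrictScalars k) | AlgPoints.embOfPoint Z P = σ}).comp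
        (pieceHomeomorphBaseChange Z σ : C(ComplexPoints ((baseChangeHom σ.toRingHom).obj Z),
          {P : ComplexPoints (Z.restrictScalars k) // AlgPoints.embOfPoint Z P = σ}))) Q).left =
      Q.left ≫ baseChangeHomFst σ.toRingHom Z :=
  pieceHomeomorphBaseChange_apply_coe_left Z σ Q

/-- **The inclusion of the `σ`-piece is natural in `Z`**: for a `K`-morphism `φ : Z ⟶ Z'`,
`ι_σ^{Z'} ∘ φ_σ(ℂ) = φ|_k(ℂ) ∘ ι_σ^Z` as continuous maps `Z_σ(ℂ) → Z'|_k(ℂ)`, where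
`ι_σ : Z_σ(ℂ) ≃ₜ {P | σ_P = σ} ⊆ Z|_k(ℂ)` (on underlying morphisms `Spec ℂ ⟶ ·` both sides are
`Q ↦ Q ≫ π_Z ≫ φ`, by `baseChangeHom_map_left_comp_fst`). [folklore] -/
theorem pieceIncl_comp_mapContinuous_baseChangeHom (φ : Z ⟶ Z') (σ : K →ₐ[k] ℂ) :
    ((subsetIncl {P : ComplexPoints (Z'.restrictScalars k) | AlgPoints.embOfPoint Z' P = σ}).comp
        (pieceHomeomorphBaseChange Z' σ : C(ComplexPoints ((baseChangeHom σ.toRingHom).obj Z'),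
          {P : ComplexPoints (Z'.restrictScalars k) // AlgPoints.embOfPoint Z' P = σ}))).comp
      (AlgPoints.mapContinuous (L := ℂ) ((baseChangeHom σ.toRingHom).map φ)) =
    (AlgPoints.mapContinuous (L := ℂ)
        ((Over.map (Spec.map (CommRingCat.ofHom (algebraMap k K)))).map φ)).comp
      ((subsetIncl {P : ComplexPoints (Z.restrictScalars k) | AlgPoints.embOfPoint Z P = σ}).comp
        (pieceHomeomorphBaseChange Z σ : C(ComplexPoints ((baseChangeHom σ.toRingHom).obj Z),
          {P : ComplexPoints (Z.restrictScalars k) // AlgPoints.embOfPoint Z P = σ}))) := by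
  ext Q : 1
  apply Over.OverMorphism.ext
  rw [ContinuousMap.comp_apply, pieceIncl_apply_left, AlgPoints.mapContinuous_apply,
    AlgPoints.map_apply, Over.comp_left, Category.assoc, baseChangeHom_map_left_comp_fst,
    ContinuousMap.comp_apply, AlgPoints.mapContinuous_apply, AlgPoints.map_apply, Over.comp_left,
    pieceIncl_apply_left, Over.map_map_left]
  exact Category.assoc (obj := Scheme) _ _ _

variable [FiniteDimensional k K]

/-- **Naturality of `Hⁱ(Z|_k(ℂ); ℚ) ≅ ∏_σ Hⁱ(Z_σ(ℂ); ℚ)` in `Z`**: for a `K`-morphism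
`φ : Z ⟶ Z'` and `z' ∈ Hⁱ(Z'|_k(ℂ); ℚ)`, the `σ`-component of `(φ|_k)* z'` is `(φ_σ)*` of the
`σ`-component of `z'` (functoriality of singular cohomology, Hatcher §3.1, applied to
`pieceIncl_comp_mapContinuous_baseChangeHom`). [cite: HatcherAT2002, §3.1] -/
theorem bettiCohomologyRestrictScalarsEquiv_map (φ : Z ⟶ Z') (i : ℕ)
    (z' : bettiCohomology (Z'.restrictScalars k) i) (σ : K →ₐ[k] ℂ) :
    bettiCohomologyRestrictScalarsEquiv Z i
        (bettiCohomology.map ((Over.map (Spec.map (CommRingCat.ofHom (algebraMap k K)))).map φ) i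
          z') σ =
      bettiCohomology.map ((baseChangeHom σ.toRingHom).map φ) i
        (bettiCohomologyRestrictScalarsEquiv Z' i z' σ) := by
  rw [bettiCohomologyRestrictScalarsEquiv_apply, bettiCohomologyRestrictScalarsEquiv_apply]
  change (singularCohomology.map ℚ ℚ (AlgPoints.mapContinuous (L := ℂ)
        ((Over.map (Spec.map (CommRingCat.ofHom (algebraMap k K)))).map φ)) i ≫
      singularCohomology.map ℚ ℚ _ i) z' =
    (singularCohomology.map ℚ ℚ _ i ≫
      singularCohomology.map ℚ ℚ (AlgPoints.mapContinuous (L := ℂ)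
        ((baseChangeHom σ.toRingHom).map φ)) i) z'
  rw [← singularCohomology.map_comp, ← singularCohomology.map_comp,
    pieceIncl_comp_mapContinuous_baseChangeHom]

/-- Naturality as an identity of linear maps `Hⁱ(Z'|_k(ℂ); ℚ) → ∏_σ Hⁱ(Z_σ(ℂ); ℚ)`:
`decomp_Z ∘ (φ|_k)* = (∏_σ (φ_σ)*) ∘ decomp_{Z'}`. [cite: HatcherAT2002, §3.1] -/
theorem bettiCohomologyRestrictScalarsEquiv_comp_map (φ : Z ⟶ Z') (i : ℕ) :
    (bettiCohomologyRestrictScalarsEquiv Z i).toLinearMap ∘ₗ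
        (bettiCohomology.map ((Over.map (Spec.map (CommRingCat.ofHom (algebraMap k K)))).map φ)
          i).hom =
      (LinearMap.pi fun σ : K →ₐ[k] ℂ =>
          (bettiCohomology.map ((baseChangeHom σ.toRingHom).map φ) i).hom ∘ₗ LinearMap.proj σ) ∘ₗ
        (bettiCohomologyRestrictScalarsEquiv Z' i).toLinearMap := by
  ext z' σ
  exact bettiCohomologyRestrictScalarsEquiv_map φ i z' σ

/-- **Equivariance under `Aut Z`**: for a `K`-automorphism `g` of `Z`, acting on `Z|_k` as
`g|_k = (Over.map _).mapAut Z g` and on `Z_σ` as `g_σ = (baseChangeHom σ).mapAut Z g`, the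
`σ`-component of `(g|_k)* z` is `(g_σ)*` of the `σ`-component of `z` (e.g. Scholl's group of
automorphisms of a Kuga–Sato variety over `ℚ(ζ_n)`, Deninger–Scholl 5.3 (i), acting on the
cohomology of the `ℚ`-scheme and of its `φ(n)` geometric components, §4.1).
[cite: DeningerScholl1991, §4.1 and 5.3 (i)] -/
theorem bettiCohomologyRestrictScalarsEquiv_map_mapAut (g : Aut Z) (i : ℕ)
    (z : bettiCohomology (Z.restrictScalars k) i) (σ : K →ₐ[k] ℂ) :
    bettiCohomologyRestrictScalarsEquiv Z i
        (bettiCohomology.map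
          ((Over.map (Spec.map (CommRingCat.ofHom (algebraMap k K)))).mapAut Z g).hom i z) σ =
      bettiCohomology.map ((baseChangeHom σ.toRingHom).mapAut Z g).hom i
        (bettiCohomologyRestrictScalarsEquiv Z i z σ) :=
  bettiCohomologyRestrictScalarsEquiv_map g.hom i z σ

/-- The same for the inverse automorphism (the form in which a group acts on cohomology by
`g ↦ (g⁻¹)*`). [cite: DeningerScholl1991, §4.1 and 5.3 (i)] -/
theorem bettiCohomologyRestrictScalarsEquiv_map_mapAut_inv (g : Aut Z) (i : ℕ)
    (z : bettiCohomology (Z.restrictScalars k) i) (σ : K →ₐ[k] ℂ) :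
    bettiCohomologyRestrictScalarsEquiv Z i
        (bettiCohomology.map
          ((Over.map (Spec.map (CommRingCat.ofHom (algebraMap k K)))).mapAut Z g).inv i z) σ =
      bettiCohomology.map ((baseChangeHom σ.toRingHom).mapAut Z g).inv i
        (bettiCohomologyRestrictScalarsEquiv Z i z σ) :=
  bettiCohomologyRestrictScalarsEquiv_map g.inv i z σ

end Literature.AlgebraicGeometry.Motives

end
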